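/-
Copyright (c) 2026. All rights reserved.
Released under Apache 2.0 license as described in the file LICENSE.
Authors: abc-iut cell, seat abc-iut-L4-t14 (gen 3; the exact ambient group `PSL₂(ℝ) = SL(2,ℝ)/{±1}` of
print's `Loc_R(X)` for the holomorphic geometric `EA`: objects `ℍ/Λ̄`, morphisms `[τ] ↦ [q • τ]`, and
SIGN-FREE fullness over abc-iut-w5-d208's Möbius lifting).
-/
import Literature.AnabelianGeometry.AbsoluteAnabelian.ArchimedeanHolFieldFunctorGeometricUpperHalfPlane
import HarnessLib

/-!
# `PSL₂(ℝ)` acting on `ℍ`: the objects `ℍ/Λ̄` of the geometric `EA` and sign-free fullness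

S. Mochizuki, *Topics in absolute anabelian geometry III*, proof of Prop 4.2 (i) p. 106 l. 14–19 (kurims
manuscript `paper:url-5493eb38cbb7`; bib key `MochizukiAbsTopIII2015`): "the full subcategory of `EA`
consisting of objects that map to `X` may … be identified with the category of finite étale
R-localizations `Loc_R(X)`"; H. M. Farkas, I. Kra, *Riemann Surfaces*, IV.5.6 «`Aut U ≅ PSL(2, ℝ)`»,
IV.7.1 (lifting to the universal covering).

abc-iut-L4-t14's `ArchimedeanHolFieldFunctorGeometricUpperHalfPlane.lean` realises `ℍ/Λ` and
`[τ] ↦ [γ • τ]` for `Λ ≤ SL(2, ℝ)`, with fullness only up to the sign `±1 = ker (SL(2, ℝ) → Aut ℍ)`.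
Here the sign is removed by passing to the group that acts FAITHFULLY:

* `HolRS.PSL2R := SL(2, ℝ) ⧸ Z(SL(2, ℝ))` (`Z = {±1}`, the tree's `mem_center_sl_iff`), with the induced
  Möbius action `HolRS.pslMulAction : MulAction PSL2R ℍ` (ONE canonical instance: `MulAction.compHom`
  along `QuotientGroup.lift` of `MulAction.toPermHom`, the centre acting trivially by the tree's
  `neg_one_sl_smul`; no competing instance exists), `psl_mk_smul : (↑γ : PSL2R) • τ = γ • τ`,
  `HolRS.pslContinuousConstSMul`, `HolRS.contMDiff_psl_smul`;
* `HolRS.pslQuotient Λ̄ : HolRS` (`ℍ/Λ̄` for `Λ̄ ≤ PSL₂(ℝ)` acting freely, properly discontinuously — i.e.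
  a torsion-free Fuchsian group), `HolRS.pslQuotientHom` (`[τ] ↦ [q • τ]`), `HolRS.pslLocFunctor Γ̄ hfin :
  LocObj Γ̄ ⥤ HolRS` (abc-iut-L4-t14's `Loc(PSL₂(ℝ), Γ̄)`, p432943, into `HolRS`);
* ★ `HolRS.exists_psl_of_hom` — **SIGN-FREE FULLNESS**: every morphism `f : ℍ/Λ̄₁ ⟶ ℍ/Λ̄₂` of `HolRS` is
  `[τ] ↦ [q • τ]` for some `q ∈ PSL₂(ℝ)` with `q Λ̄₁ q⁻¹ ≤ Λ̄₂` — i.e. comes from a morphism `[q] : Λ̄₁ → Λ̄₂`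
  of `Loc(PSL₂(ℝ), Γ̄)` (abc-iut-w5-d208's `UniformizedLift.exists_sl_lift` / `conj_mem_of_sl_lift`
  applied to the preimage of `Λ̄₂` in `SL(2, ℝ)`, which contains `-1`).

So, at the uniformised model, the holomorphic morphisms of the geometric `EA` between objects over
`X = ℍ/Γ̄` are EXACTLY the morphisms of the group model `Loc(PSL₂(ℝ), Γ̄)`; what is not constructed here is
essential surjectivity (every object mapping to `X` is an `ℍ/Λ̄`: uniformisation / the topological
Galois correspondence) and the anti-holomorphic coset of print's RC-category.  MODEL ≠ reconstruction;
campaign-L support (GAP row G-L4t14-R1, J1); nothing here bears on [IUTchIII] Cor. 3.12; typed ≠ proved.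
-/

set_option autoImplicit false

noncomputable section

open scoped Manifold ContDiff Topology UpperHalfPlane MatrixGroups
open _root_.MulAction _root_.CategoryTheory

namespace Literature.AnabelianGeometry.AbsoluteAnabelian

namespace HolRS

/-! ### `PSL₂(ℝ)` and its faithful Möbius action on `ℍ` -/

/-- **`PSL₂(ℝ) := SL(2, ℝ) / Z(SL(2, ℝ))`**, `Z = {±1}` (Farkas–Kra IV.5.6 «`Aut U ≅ PSL(2, ℝ)`»).
[cite: FarkasKra1992, IV.5.6] -/
abbrev PSL2R : Type := SL(2, ℝ) ⧸ Subgroup.center SL(2, ℝ)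

/-- The centre `{±1}` of `SL(2, ℝ)` acts trivially on `ℍ`. [cite: FarkasKra1992, IV.5.6] -/
theorem center_le_ker_toPermHom :
    Subgroup.center SL(2, ℝ) ≤ (MulAction.toPermHom SL(2, ℝ) ℍ).ker := by
  intro g hg
  rw [MonoidHom.mem_ker]
  refine Equiv.ext fun τ => ?_
  change g • τ = τ
  rcases mem_center_sl_iff.mp hg with rfl | rfl
  · exact one_smul _ τ
  · exact neg_one_sl_smul τ

/-- The Möbius action of `PSL₂(ℝ)` on `ℍ` as a homomorphism to `Perm ℍ`. [cite: FarkasKra1992, IV.5.6] -/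
def pslToPerm : PSL2R →* Equiv.Perm ℍ :=
  QuotientGroup.lift (Subgroup.center SL(2, ℝ)) (MulAction.toPermHom SL(2, ℝ) ℍ) center_le_ker_toPermHom

/-- **The Möbius action of `PSL₂(ℝ)` on `ℍ`** (the one canonical instance; induced from Mathlib's
`SL(2, ℝ)`-action, the centre acting trivially). [cite: FarkasKra1992, IV.5.6] -/
instance pslMulAction : MulAction PSL2R ℍ := MulAction.compHom ℍ pslToPerm

/-- `(↑γ) • τ = γ • τ`. [cite: FarkasKra1992, IV.5.6] -/
@[simp] theorem psl_mk_smul (γ : SL(2, ℝ)) (τ : ℍ) : (QuotientGroup.mk γ : PSL2R) • τ = γ • τ := rfl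

/-- The action is FAITHFUL: only the identity of `PSL₂(ℝ)` acts trivially. [cite: FarkasKra1992, IV.5.6] -/
theorem psl_eq_one_of_forall_smul_eq {q : PSL2R} (h : ∀ τ : ℍ, q • τ = τ) : q = 1 := by
  induction q using QuotientGroup.induction_on with
  | H γ =>
    rw [← QuotientGroup.mk_one, QuotientGroup.eq, mul_one]
    have : γ ∈ Subgroup.center SL(2, ℝ) := by
      rw [mem_center_sl_iff]
      exact eq_or_eq_neg_of_smul_eq (h _) (h _)
    exact (Subgroup.center SL(2, ℝ)).inv_mem this

/-- `PSL₂(ℝ)` acts by homeomorphisms. [cite: FarkasKra1992, IV.5.6] -/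
instance pslContinuousConstSMul : ContinuousConstSMul PSL2R ℍ where
  continuous_const_smul q := by
    induction q using QuotientGroup.induction_on with
    | H γ =>
      have : (fun τ : ℍ => (QuotientGroup.mk γ : PSL2R) • τ) = fun τ : ℍ => γ • τ := rfl
      rw [this]
      exact continuous_const_smul γ

/-- `PSL₂(ℝ)` acts by biholomorphisms: `τ ↦ q • τ` is `C^ω`. [cite: FarkasKra1992, IV.5.6] -/
theorem contMDiff_psl_smul (q : PSL2R) : ContMDiff 𝓘(ℂ, ℂ) 𝓘(ℂ, ℂ) ω (fun τ : ℍ => q • τ) := by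
  induction q using QuotientGroup.induction_on with
  | H γ => exact contMDiff_sl_smul γ

/-- The same on the carrier of `upperHalfPlane`. [cite: FarkasKra1992, IV.5.6] -/
theorem contMDiff_psl_smul_carrier (q : PSL2R) :
    ContMDiff 𝓘(ℂ, ℂ) 𝓘(ℂ, ℂ) ω (fun τ : upperHalfPlane.carrier => q • τ) :=
  contMDiff_psl_smul q

/-! ### The objects `ℍ/Λ̄`, the morphisms `[τ] ↦ [q • τ]`, the functor from `Loc(PSL₂(ℝ), Γ̄)` -/

/-- **`ℍ/Λ̄` as an object of `HolRS`** for `Λ̄ ≤ PSL₂(ℝ)` acting freely and properly discontinuously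
(a torsion-free Fuchsian group). [cite: MochizukiAbsTopIII2015, Definition 4.1 (i) p.101] -/
def pslQuotient (Λ : Subgroup PSL2R) [ProperlyDiscontinuousSMul Λ ℍ] [IsCancelSMul Λ ℍ] : HolRS :=
  ofQuotient upperHalfPlane Λ contMDiff_psl_smul_carrier

/-- Its carrier is the orbit space. [cite: MochizukiAbsTopIII2015, Definition 4.1 (i) p.101] -/
theorem pslQuotient_carrier (Λ : Subgroup PSL2R) [ProperlyDiscontinuousSMul Λ ℍ] [IsCancelSMul Λ ℍ] :
    (pslQuotient Λ).carrier = orbitRel.Quotient Λ ℍ := rfl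

/-- **`[τ] ↦ [q • τ] : ℍ/Λ̄₁ ⟶ ℍ/Λ̄₂`** for `q Λ̄₁ q⁻¹ ≤ Λ̄₂` of finite index in `Λ̄₂`.
[cite: MochizukiAbsTopIII2015, Definition 4.1 (iii) p.103] -/
def pslQuotientHom (Λ₁ Λ₂ : Subgroup PSL2R) [ProperlyDiscontinuousSMul Λ₁ ℍ] [IsCancelSMul Λ₁ ℍ]
    [ProperlyDiscontinuousSMul Λ₂ ℍ] [IsCancelSMul Λ₂ ℍ] (q : PSL2R) (h : ∀ x ∈ Λ₁, q * x * q⁻¹ ∈ Λ₂)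
    [((Literature.Geometry.Manifold.QuotientManifold.conjSubgroup q Λ₁).subgroupOf Λ₂).FiniteIndex] :
    pslQuotient Λ₁ ⟶ pslQuotient Λ₂ :=
  quotientHom upperHalfPlane Λ₁ Λ₂ contMDiff_psl_smul_carrier q h

/-- Its underlying map on classes. [cite: MochizukiAbsTopIII2015, Definition 4.1 (iii) p.103] -/
theorem pslQuotientHom_toFun_mk (Λ₁ Λ₂ : Subgroup PSL2R) [ProperlyDiscontinuousSMul Λ₁ ℍ]
    [IsCancelSMul Λ₁ ℍ] [ProperlyDiscontinuousSMul Λ₂ ℍ] [IsCancelSMul Λ₂ ℍ] (q : PSL2R)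
    (h : ∀ x ∈ Λ₁, q * x * q⁻¹ ∈ Λ₂)
    [((Literature.Geometry.Manifold.QuotientManifold.conjSubgroup q Λ₁).subgroupOf Λ₂).FiniteIndex]
    (τ : ℍ) :
    (pslQuotientHom Λ₁ Λ₂ q h).toFun (Quotient.mk _ τ) = Quotient.mk _ (q • τ) := rfl

/-- **The functor `Loc(PSL₂(ℝ), Γ̄) ⥤ HolRS`**, `Λ̄ ↦ ℍ/Λ̄`, `[q] ↦ ([τ] ↦ [q • τ])`, under the finite-fibre
hypothesis `hfin`. [cite: MochizukiAbsTopIII2015, Proposition 4.2 (i) proof p.106] -/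
def pslLocFunctor (Γ : Subgroup PSL2R) [ProperlyDiscontinuousSMul Γ ℍ] [IsCancelSMul Γ ℍ]
    (hfin : ∀ (g : PSL2R) (Λ₁ Λ₂ : LocObj Γ),
      (∀ x ∈ Λ₁.toSubgroup, g * x * g⁻¹ ∈ Λ₂.toSubgroup) →
      ((Literature.Geometry.Manifold.QuotientManifold.conjSubgroup g Λ₁.toSubgroup).subgroupOf
        Λ₂.toSubgroup).FiniteIndex) :
    LocObj Γ ⥤ HolRS :=
  LocObj.toHolRS upperHalfPlane contMDiff_psl_smul_carrier Γ hfin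

/-! ### Sign-free fullness -/

/-- **Every morphism `ℍ/Λ̄₁ ⟶ ℍ/Λ̄₂` of `HolRS` is `[τ] ↦ [q • τ]` with `q ∈ PSL₂(ℝ)`, `q Λ̄₁ q⁻¹ ≤ Λ̄₂`**:
lift `f` to `γ ∈ SL(2, ℝ)` (`UniformizedLift.exists_sl_lift`), set `q := ↑γ`; the preimage of `Λ̄₂` in
`SL(2, ℝ)` contains `-1` and acts as the covering group of `ℍ → ℍ/Λ̄₂`, so `γ δ γ⁻¹` lies in it for every
lift `δ` of an element of `Λ̄₁` (`UniformizedLift.conj_mem_of_sl_lift`).  Hence the holomorphic morphisms of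
the geometric `EA` between uniformised objects are exactly those of `Loc(PSL₂(ℝ), Γ̄)`.
[cite: MochizukiAbsTopIII2015, Proposition 4.2 (i) proof p.106] -/
theorem exists_psl_of_hom (Λ₁ Λ₂ : Subgroup PSL2R) [ProperlyDiscontinuousSMul Λ₁ ℍ] [IsCancelSMul Λ₁ ℍ]
    [ProperlyDiscontinuousSMul Λ₂ ℍ] [IsCancelSMul Λ₂ ℍ] (f : pslQuotient Λ₁ ⟶ pslQuotient Λ₂) :
    ∃ q : PSL2R, (∀ τ : ℍ, f.toFun (Quotient.mk _ τ) = Quotient.mk _ (q • τ)) ∧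
      ∀ x ∈ Λ₁, q * x * q⁻¹ ∈ Λ₂ := by
  let π₁ : ℍ → (pslQuotient Λ₁).carrier := Quotient.mk (orbitRel Λ₁ ℍ)
  let π₂ : ℍ → (pslQuotient Λ₂).carrier := Quotient.mk (orbitRel Λ₂ ℍ)
  have hπ₁ : IsCoveringMap π₁ :=
    (isQuotientCoveringMap_quotientMk_of_properlyDiscontinuousSMul (G := Λ₁) (E := ℍ)).isCoveringMap
  have hπ₂ : IsCoveringMap π₂ :=
    (isQuotientCoveringMap_quotientMk_of_properlyDiscontinuousSMul (G := Λ₂) (E := ℍ)).isCoveringMap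
  have dπ₁ : MDifferentiable 𝓘(ℂ, ℂ) 𝓘(ℂ, ℂ) π₁ :=
    (Literature.Geometry.Manifold.QuotientManifold.contMDiff_mk (G := Λ₁) (n := ω)
      (fun k => contMDiff_psl_smul (k : PSL2R))).mdifferentiable (by simp)
  have dπ₂ : MDifferentiable 𝓘(ℂ, ℂ) 𝓘(ℂ, ℂ) π₂ :=
    (Literature.Geometry.Manifold.QuotientManifold.contMDiff_mk (G := Λ₂) (n := ω)
      (fun k => contMDiff_psl_smul (k : PSL2R))).mdifferentiable (by simp)
  obtain ⟨e₂, he₂⟩ := Quotient.exists_rep (f.toFun (π₁ UpperHalfPlane.I))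
  have he : f.toFun (π₁ UpperHalfPlane.I) = π₂ e₂ := he₂.symm
  obtain ⟨γ, hγ, -⟩ := UniformizedLift.exists_sl_lift hπ₁ hπ₂ f.isFiniteEtale.isCoveringMap dπ₁ dπ₂
    f.mdifferentiable he
  refine ⟨QuotientGroup.mk γ, fun τ => (hγ τ).symm, fun x hx => ?_⟩
  -- the preimage of `Λ̄₂` in `SL(2, ℝ)`: contains `-1`, acts as the covering group of `π₂`
  let Λ₂' : Subgroup SL(2, ℝ) := Λ₂.comap (QuotientGroup.mk' (Subgroup.center SL(2, ℝ)))
  have hneg : (-1 : SL(2, ℝ)) ∈ Λ₂' := by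
    change (QuotientGroup.mk (-1) : PSL2R) ∈ Λ₂
    have : (QuotientGroup.mk (-1) : PSL2R) = 1 := by
      rw [← QuotientGroup.mk_one, QuotientGroup.eq, mul_one]
      exact (Subgroup.center SL(2, ℝ)).inv_mem (mem_center_sl_iff.mpr (Or.inr rfl))
    rw [this]
    exact Λ₂.one_mem
  have hdeck : ∀ μ ∈ Λ₂', ∀ τ : ℍ, π₂ (μ • τ) = π₂ τ := fun μ hμ τ =>
    Quotient.sound ⟨⟨QuotientGroup.mk μ, hμ⟩, rfl⟩
  have horb : ∀ τ τ' : ℍ, π₂ τ = π₂ τ' → ∃ μ ∈ Λ₂', μ • τ = τ' := by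
    intro τ τ' h
    obtain ⟨m, hm⟩ := Quotient.exact h
    obtain ⟨μ, hμ⟩ := QuotientGroup.mk_surjective ((m⁻¹ : Λ₂) : PSL2R)
    refine ⟨μ, ?_, ?_⟩
    · change (QuotientGroup.mk μ : PSL2R) ∈ Λ₂
      rw [hμ]
      exact (m⁻¹).2
    · rw [← psl_mk_smul, hμ, ← hm]
      exact inv_smul_smul m τ'
  -- a lift `δ ∈ SL(2, ℝ)` of `x ∈ Λ̄₁` is a deck transformation of `π₁`
  obtain ⟨δ, hδ⟩ := QuotientGroup.mk_surjective x
  have hδ' : ∀ τ : ℍ, π₁ (δ • τ) = π₁ τ := fun τ => by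
    rw [← psl_mk_smul, hδ]
    exact Quotient.sound ⟨⟨x, hx⟩, rfl⟩
  have hconj := UniformizedLift.conj_mem_of_sl_lift hπ₂ Λ₂' hneg hdeck horb hγ hδ'
  -- read the conclusion in `PSL₂(ℝ)`
  change (QuotientGroup.mk (γ * δ * γ⁻¹) : PSL2R) ∈ Λ₂ at hconj
  rw [QuotientGroup.mk_mul, QuotientGroup.mk_mul, QuotientGroup.mk_inv, hδ] at hconj
  exact hconj

end HolRS

end Literature.AnabelianGeometry.AbsoluteAnabelian

end
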